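import Summits.QuantumFields.YangMills.Theorems.FluctuationComparisonRegPrIntLS2BetaLadderHolonomy
import Literature.MathematicalPhysics.QuantumFieldTheory.Balaban1983to89.B14Eq213DetSet
import Literature.MathematicalPhysics.QuantumFieldTheory.Balaban1983to89.B9B8KnitAveragingClosenessAtCorner
import Literature.MathematicalPhysics.QuantumFieldTheory.Balaban1983to89.B15Prop1ChartCalculusSU2
import Literature.MathematicalPhysics.QuantumFieldTheory.Balaban1983to89.T4ExpWindowSmallField
import Literature.MathematicalPhysics.QuantumFieldTheory.Balaban1983to89.T4StairWordPrefix
import HarnessLib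

/-!
# S2β ∕ GAP♯∘ strata residue, (RINV-curl) brick (B4b) — THE COMB TRANSPORTER ON A `k`-BLOCK AND ITS THIN FUNDAMENTAL CYCLES
# (generic `P : Params`, any `GaugeGroup G`; the `ℝ³`∕`SU(2)` defect bound in the door's currency; DEFINITION-FREE)

Cell `ym3-torus` (YM ladder rung R3 = continuum `SU(2)` Yang–Mills on the three-torus — a RUNG: NOT d = 4, NOT infinite volume,
NOT a mass gap, NOT Clay).  Width seat «width 13» `ym3-torus-px13` (gen 25), FREE px helper on crux `stmt-QuantumFields-20520`
(`FluctuationComparisonRegPrIntL`), count-neutral, DEFINITION-FREE (0 `def`, 0 `instance`, 0 `notation`, 0 `sorry`), default heartbeats.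

WHY.  On the face-preimage road to (RINV-curl) (UV3-NODE §75.11; (B3′) ✓`…S2BetaFacePreimageIdentity`, door ✓`…S2BetaPreimagesOfFaceSpreads`)
the generator on the block `B^k(x)` is `λ(z) = Ad_{H(z)⁻¹} v̂` for a COMB TRANSPORTER `H` rooted at `ι_k x`; the interior defect
`I(b) = λ(b₋) − Ad_{U₀(b)} λ(b₊) = Ad_{H(b₋)⁻¹}(v̂ − Ad_{W_b} v̂)` is governed by the fundamental cycle `W_b = H(b₋)·U₀(b)·H(b₊)⁻¹`, a THIN loop.

THE COMB (spelling fixed here for the consumers).  Level `k ≤ m + K`, coarse site `x : Site P k`, ROOT `embIter k x` (the block centre,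
lit ✓`val_embIter`: label `x·L^k + (L^k − 1)∕2`), CENTRED OFFSETS `n_x(z) a := (z a).val − (embIter k x a).val ∈ ℤ` (`|n_x(z) a| ≤ (L^k − 1)∕2` on the block),
an axis order `σ : Equiv.Perm (Fin d)` (a parameter throughout), and  `H z := holAt U₀ (walk (embIter k x) (stairWord σ n_x(z)))`
(lit `BlockAveraging.stairWord` = the signed runs `axisRun (σ 0) (n (σ 0)) ++ axisRun (σ 1) (n (σ 1)) ++ …`; lit `T4Continuum.walk ∕ holAt`).

WHAT.  §1 the stair-word surgery is lit ✓`T4StairWordPrefix.stairWord_update_decomp` (`stairWord σ n = P·ρ_s·R`, `stairWord σ (n + e_ν) = P·ρ_t·R`, `{ρ_s, ρ_t} = {∅, ±ν}`,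
`R` = the runs of the axes after `ν`); here only `stairRuns_zero`.  §2 ★★`dist1_surgery_cycle_le` (any level, any `GaugeGroup`):
`dist1 (U(r; W₁·ν^m·W₂) · U⟨end, ν⟩ · U(r; W₁·ν^{m+1}·W₂)⁻¹) ≤ |W₂|·δ` — either sign of `m` gives a prefix-conjugate of the LADDER of ✓(B4a) `dist1_ladder_le`.
§3 the block: `walkEnd_comb`, `holAt_comb_root` (`H(ι_k x) = 1`), `natAbs_offset_le`, `val_shift_of_blockIter_eq` ∕ `offset_shift` (no torus wrap inside a block),
★★★`dist1_comb_cycle_le`: `B^k(z) = B^k(z + e_ν) = x ⟹ dist1 (H z · U₀⟨z, ν⟩ · H(z + e_ν)⁻¹) ≤ (d − 1)·((L^k − 1)∕2)·δ`.  §4 (`SU(2)`, the door's `ℝ³` currency):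
`norm_adSU2_sub_self_le` (`‖Ad_g X − X‖ ≤ 2·dist1 g·‖X‖`), `norm_adSU2_inv_sub_adSU2_le`, ★★`norm_comb_defect_le`, ★★★`norm_interiorPart_le`: the interior part
`I_w b := [B^k(b₋) = B^k(b₊) = x]·(λ b₋ − Ad_{U₀ b} λ b₊)`, `λ z = Ad_{H(z)⁻¹} w`, has **`‖I_w‖_∞ ≤ (d − 1)·(L^k − 1)·δ·‖w‖`** — with the background's
`δ = θ₀ = C₁θ_J·(L^k)⁻²` this is the thin-loop letter `‖I_w‖_∞ ≤ c_I·θ_J·(L^{K−J})⁻¹·‖w‖`, `c_I = (d − 1)C₁`, of the closing door.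

HONEST SCOPE.  Lattice bookkeeping on the tree's own torus words and one triangle inequality in `ℍ`; nothing of Bałaban's analysis is asserted; (B5), the
closing door, (RINV-curl), MULT♮, AVG₂♭-ax, «CRIT-ax», (D-ax), GAP♯∘ (`stub_uniformFibreGapOrbit`; registry `Lines/semiclassical_s2beta.lean` 3732b7df UNTOUCHED),
the five registered stubs, S2β, crux 20520, 19936, 19200 and `YM3TorusSU2` are NOT proved; no registered stub is closed; the Yang–Mills mass gap is NOT proved.
Sorry-free, axioms standard.

References: T. Bałaban, CMP **109** (1987) 249–301 [Balaban1987RG1] ((0.1)–(0.3) pp.251–252: lattices, blocks, staircase contours `G(y, x)`); CMP **122** (1989)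
355–392 [Balaban1989LargeFieldII] (p.382: a tree-gauge bond variable is a loop spanned by plaquettes); CMP **98** (1985) 17–51 [Balaban1985Averaging] ((8)–(9) pp.18–19, (125) p.36).
-/
set_option autoImplicit false

namespace Summit.QuantumFields.YangMills.Theorems.FluctuationComparisonRegPrIntLS2BetaCombTransporter

open Literature.MathematicalPhysics.QuantumFieldTheory.Balaban1983to89
open Literature.MathematicalPhysics.QuantumFieldTheory.Balaban1983to89.T4Continuum
open Literature.MathematicalPhysics.QuantumFieldTheory.Balaban1983to89.BlockAveraging
open Literature.MathematicalPhysics.QuantumFieldTheory.Balaban1983to89.B14.Eq22Determines (blockIter)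
open Literature.MathematicalPhysics.QuantumFieldTheory.Balaban1983to89.B15DeterminingSets (embIter)
open Summit.QuantumFields.YangMills.Theorems.FluctuationComparisonRegPrIntLS2BetaLadderHolonomy (dist1_ladder_le)

/-! ## §1 Word surgery on staircases -/

section Words

variable {d : ℕ}
/-- The zero offset has the empty staircase. [cite: Balaban1987RG1, (0.3) p.252 (bookkeeping)] -/
theorem stairRuns_zero : ∀ (as : List (Fin d)), stairRuns (fun _ => (0 : ℤ)) as = []
  | [] => rfl
  | a :: as => by rw [stairRuns, stairRuns_zero as]; rfl

end Words

/-! ## §2 The surgery cycle is a conjugated ladder -/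

section Cycle

variable {P : Params} {j : ℕ} {G : Type*} [GaugeGroup G]
/-- Inserting one FORWARD letter `+ν` between `V` and `W`: the cycle `U(r; V·W) · U⟨end, ν⟩ · U(r; V·(+ν)·W)⁻¹` is the conjugate by `U(r; V)` of the ladder swept by
`W` from `walkEnd r V`, hence within `|W|·δ` of `1` (✓(B4a) `dist1_ladder_le`). [cite: Balaban1989LargeFieldII, p.382; Balaban1985Averaging, (9) p.19] -/
theorem dist1_cycle_insert_true_le (U : GaugeField P j G) {δ : ℝ} (hδ : 0 ≤ δ)
    (hU : ∀ q : Plaq P j, dist1 (GaugeField.plaqHol U q) ≤ δ) (r : Site P j) (V W : List (Letter P.d)) (ν : Fin P.d) :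
    dist1 (holAt U (walk r (V ++ W)) * U ⟨walkEnd r (V ++ W), ν⟩ * (holAt U (walk r (V ++ [(ν, true)] ++ W)))⁻¹) ≤
      W.length * δ := by
  have hlad := dist1_ladder_le U hδ hU ν W (walkEnd r V)
  rw [List.append_assoc, List.singleton_append, walk_append, walk_append, holAt_append, holAt_append, walkEnd_append]
  simp only [walk, holAt_cons, if_true]
  set A := holAt U (walk r V)
  set p := walkEnd r V
  set B := holAt U (walk p W)
  set C := holAt U (walk (p.shift ν) W)
  have key : A * B * U ⟨walkEnd p W, ν⟩ * (A * (U ⟨p, ν⟩ * C))⁻¹ =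
      A * (B * U ⟨walkEnd p W, ν⟩ * C⁻¹ * (U ⟨p, ν⟩)⁻¹) * A⁻¹ := by group
  rw [key, GaugeGroup.dist1_conj]; exact hlad

/-- Inserting one BACKWARD letter `−ν` between `V` and `W`: the cycle `U(r; V·(−ν)·W) · U⟨end, ν⟩ · U(r; V·W)⁻¹` is the conjugate by `U(r; V)·U⟨p, ν⟩⁻¹`
(`p = walkEnd r V − e_ν`) of the ladder swept by `W` from `p`, hence within `|W|·δ` of `1`. [cite: Balaban1989LargeFieldII, p.382; Balaban1985Averaging, (9) p.19] -/
theorem dist1_cycle_insert_false_le (U : GaugeField P j G) {δ : ℝ} (hδ : 0 ≤ δ)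
    (hU : ∀ q : Plaq P j, dist1 (GaugeField.plaqHol U q) ≤ δ) (r : Site P j) (V W : List (Letter P.d)) (ν : Fin P.d) :
    dist1 (holAt U (walk r (V ++ [(ν, false)] ++ W)) * U ⟨walkEnd r (V ++ [(ν, false)] ++ W), ν⟩ * (holAt U (walk r (V ++ W)))⁻¹) ≤
      W.length * δ := by
  have hlad := dist1_ladder_le U hδ hU ν W ((walkEnd r V).unshift ν)
  rw [Site.shift_unshift] at hlad
  rw [List.append_assoc, List.singleton_append, walk_append, walk_append, holAt_append, holAt_append, walkEnd_append]
  simp only [walk, walkEnd, holAt_cons, Bool.false_eq_true, ↓reduceIte]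
  set A := holAt U (walk r V)
  set p' := walkEnd r V
  set B := holAt U (walk (p'.unshift ν) W)
  set C := holAt U (walk p' W)
  have key : A * ((U ⟨p'.unshift ν, ν⟩)⁻¹ * B) * U ⟨walkEnd (p'.unshift ν) W, ν⟩ * (A * C)⁻¹ =
      (A * (U ⟨p'.unshift ν, ν⟩)⁻¹) * (B * U ⟨walkEnd (p'.unshift ν) W, ν⟩ * C⁻¹ * (U ⟨p'.unshift ν, ν⟩)⁻¹) *
        (A * (U ⟨p'.unshift ν, ν⟩)⁻¹)⁻¹ := by group
  rw [key, GaugeGroup.dist1_conj]; exact hlad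

/-- ★★ **THE SURGERY CYCLE**: for any root `r`, words `W₁, W₂`, axis `ν` and run length `m : ℤ`, when every plaquette is within `δ ≥ 0` of `1`,
  `dist1 (U(r; W₁·ν^m·W₂) · U⟨walkEnd, ν⟩ · U(r; W₁·ν^{m+1}·W₂)⁻¹) ≤ |W₂|·δ`
— for `m ≥ 0` the longer run is `ν^m·(+ν)`, for `m < 0` the shorter run is `ν^m = ν^{m+1}·(−ν)`; either way a prefix-conjugate of the ladder swept by `W₂`.
[cite: Balaban1987RG1, (0.3) p.252; Balaban1989LargeFieldII, p.382] -/
theorem dist1_surgery_cycle_le (U : GaugeField P j G) {δ : ℝ} (hδ : 0 ≤ δ)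
    (hU : ∀ q : Plaq P j, dist1 (GaugeField.plaqHol U q) ≤ δ) (r : Site P j) (W₁ W₂ : List (Letter P.d)) (ν : Fin P.d) (m : ℤ) :
    dist1 (holAt U (walk r (W₁ ++ axisRun ν m ++ W₂)) * U ⟨walkEnd r (W₁ ++ axisRun ν m ++ W₂), ν⟩ *
        (holAt U (walk r (W₁ ++ axisRun ν (m + 1) ++ W₂)))⁻¹) ≤ W₂.length * δ := by
  rcases le_or_gt 0 m with hm | hm
  · rw [T4StairWordPrefix.axisRun_succ_of_nonneg ν hm]
    have h := dist1_cycle_insert_true_le U hδ hU r (W₁ ++ axisRun ν m) W₂ ν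
    simpa only [List.append_assoc] using h
  · rw [T4StairWordPrefix.axisRun_eq_append_of_neg ν hm]
    have h := dist1_cycle_insert_false_le U hδ hU r (W₁ ++ axisRun ν (m + 1)) W₂ ν
    simpa only [List.append_assoc] using h

end Cycle

/-! ## §3 The comb transporter on a `k`-block -/

section Comb

variable {P : Params} {G : Type*} [GaugeGroup G]
/-- The comb path of `z` ends at `z` (lit ✓`walkEnd_stairWord_apply`: a staircase with offsets `n` ends at `root + n`). [cite: Balaban1987RG1, (0.3) p.252] -/
theorem walkEnd_comb {k : ℕ} (x : Site P k) (σ : Equiv.Perm (Fin P.d)) (z : Site P 0) :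
    walkEnd (embIter k x) (stairWord σ (fun a => ((z a).val : ℤ) - (((embIter k x) a).val : ℤ))) = z := by
  funext a
  rw [BlockAveragingEMLProp2.walkEnd_stairWord_apply]
  push_cast
  rw [ZMod.natCast_zmod_val, ZMod.natCast_zmod_val, add_sub_cancel]

/-- The comb transporter at the root is `1` (zero offsets, empty staircase). [cite: Balaban1987RG1, (0.3) p.252] -/
theorem holAt_comb_root {k : ℕ} (U : GaugeField P 0 G) (x : Site P k) (σ : Equiv.Perm (Fin P.d)) :
    holAt U (walk (embIter k x) (stairWord σ (fun a => (((embIter k x) a).val : ℤ) - (((embIter k x) a).val : ℤ)))) = 1 := by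
  have h0 : (fun a => (((embIter k x) a).val : ℤ) - (((embIter k x) a).val : ℤ)) = fun _ => (0 : ℤ) := funext fun a => sub_self _
  rw [h0, stairWord, stairRuns_zero]
  exact holAt_nil U

/-- **CENTRED OFFSETS ARE AT MOST HALF A BLOCK**: for `z ∈ B^k(x)` and every axis, `|(z a).val − (embIter k x a).val| ≤ (L^k − 1)∕2` (lit ✓`val_blockIter`:
`B^k(z)_a = z_a ∕ L^k`; lit ✓`val_embIter`: the root's label is `x_a·L^k + (L^k − 1)∕2`; `L^k` odd). [cite: Balaban1987RG1, (0.1) p.251, (0.3) p.252 (`|n_μ| ≤ (L−1)∕2`)] -/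
theorem natAbs_offset_le {k : ℕ} (hk : k ≤ P.m + P.K) (x : Site P k) {z : Site P 0} (hz : blockIter k z = x) (a : Fin P.d) :
    (((z a).val : ℤ) - (((embIter k x) a).val : ℤ)).natAbs ≤ (P.L ^ k - 1) / 2 := by
  have hv := B14.Eq213DetSet.val_blockIter hk z a
  rw [hz] at hv
  have hr := B9B8KnitAveragingClosenessAtCorner.val_embIter hk x a
  obtain ⟨t, ht⟩ : Odd (P.L ^ k) := P.hL.1.pow
  have hmod := Nat.mod_lt ((z a).val) (pow_pos P.L_pos k)
  have hdec := Nat.div_add_mod' ((z a).val) (P.L ^ k)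
  rw [← hv] at hdec
  rw [hr]
  obtain ⟨Q, hQ⟩ : ∃ Q, (x a).val * P.L ^ k = Q := ⟨_, rfl⟩
  obtain ⟨R, hR⟩ : ∃ R, (z a).val % P.L ^ k = R := ⟨_, rfl⟩
  obtain ⟨N, hN⟩ : ∃ N, P.L ^ k = N := ⟨_, rfl⟩
  rw [hQ, hR] at hdec
  rw [hR, hN] at hmod
  rw [hN] at ht
  rw [hQ, hN]
  omega

/-- **NO TORUS WRAP INSIDE A BLOCK**: if `z` and `z + e_ν` lie in the same `k`-block (`k ≤ m + K`, so there are `2L^{m+K−k} ≥ 2` blocks per direction), the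
`ν`-label of `z + e_ν` is the `ν`-label of `z` plus one. [cite: Balaban1987RG1, (0.1) p.251 (bookkeeping)] -/
theorem val_shift_of_blockIter_eq {k : ℕ} (hk : k ≤ P.m + P.K) {z : Site P 0} {ν : Fin P.d}
    (h : blockIter k (z.shift ν) = blockIter k z) : ((z.shift ν) ν).val = (z ν).val + 1 := by
  have hS : P.sitesPerDir 0 = 2 * P.L ^ (P.m + P.K) := by simp [Params.sitesPerDir]
  have hNle : P.L ^ k ≤ P.L ^ (P.m + P.K) := Nat.pow_le_pow_right P.L_pos hk
  have hNpos : 0 < P.L ^ k := pow_pos P.L_pos k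
  have h1 : ((1 : ZMod (P.sitesPerDir 0))).val = 1 := by
    rw [ZMod.val_one_eq_one_mod, Nat.mod_eq_of_lt (by rw [hS]; omega)]
  have hval : ((z.shift ν) ν).val = ((z ν).val + 1) % P.sitesPerDir 0 := by
    simp only [Site.shift, Function.update_self]
    rw [ZMod.val_add, h1]
  have hlt := ZMod.val_lt (z ν)
  rcases Nat.lt_or_ge ((z ν).val + 1) (P.sitesPerDir 0) with hlt' | hge
  · rw [hval, Nat.mod_eq_of_lt hlt']
  · exfalso
    have heq : (z ν).val + 1 = P.sitesPerDir 0 := le_antisymm hlt hge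
    have h0 : ((z.shift ν) ν).val = 0 := by rw [hval, heq, Nat.mod_self]
    have hb : ((blockIter k (z.shift ν)) ν).val = ((blockIter k z) ν).val := by rw [h]
    rw [B14.Eq213DetSet.val_blockIter hk, B14.Eq213DetSet.val_blockIter hk, h0, Nat.zero_div] at hb
    -- `(S − 1) ∕ L^k = 0` forces `S ≤ L^k`, absurd
    have heq' : (z ν).val + 1 = 2 * P.L ^ (P.m + P.K) := heq.trans hS
    have hge' : P.L ^ k ≤ (z ν).val := by omega
    have hpos : 0 < (z ν).val / P.L ^ k := Nat.div_pos hge' hNpos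
    omega

/-- The centred offsets of `z + e_ν` are those of `z` with the `ν`-entry raised by one, when both lie in `B^k(x)`. [cite: Balaban1987RG1, (0.3) p.252 (bookkeeping)] -/
theorem offset_shift {k : ℕ} (hk : k ≤ P.m + P.K) (x : Site P k) {z : Site P 0} {ν : Fin P.d}
    (hz : blockIter k z = x) (hz' : blockIter k (z.shift ν) = x) :
    (fun a => (((z.shift ν) a).val : ℤ) - (((embIter k x) a).val : ℤ)) =
      Function.update (fun a => ((z a).val : ℤ) - (((embIter k x) a).val : ℤ)) ν
        ((((z ν).val : ℤ) - (((embIter k x) ν).val : ℤ)) + 1) := by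
  funext a
  by_cases ha : a = ν
  · subst ha
    rw [Function.update_self, val_shift_of_blockIter_eq hk (hz'.trans hz.symm)]
    push_cast
    ring
  · rw [Function.update_of_ne ha]
    simp only [Site.shift, Function.update_of_ne ha]

/-- ★★★ **THE INTERIOR FUNDAMENTAL CYCLES OF THE COMB ARE THIN.**  For `k ≤ m + K`, a configuration `U` whose level-`0` plaquettes are all within `δ ≥ 0` of `1`,
any axis order `σ`, a coarse site `x`, and a finest bond `⟨z, ν⟩` with BOTH endpoints in the block `B^k(x)`:
  `dist1 (H z · U⟨z, ν⟩ · H(z + e_ν)⁻¹) ≤ (d − 1)·((L^k − 1)∕2)·δ`,  `H z = holAt U (walk (embIter k x) (stairWord σ n_x(z)))`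
— by the surgery `stairWord σ n_x(z + e_ν) = P·ρ_t·R` vs `stairWord σ n_x(z) = P·ρ_s·R` (`offset_shift`, lit ✓`T4StairWordPrefix.stairWord_update_decomp`) the cycle is a
prefix-conjugate of the ladder swept by the LATER runs `R` (✓`dist1_cycle_insert_true_le ∕ _false_le`), of length `≤ (d − 1)·(L^k − 1)∕2` (`natAbs_offset_le`); bonds along σ's
last axis are tree bonds (`R = ∅`).
[cite: Balaban1987RG1, (0.3) p.252; Balaban1989LargeFieldII, p.382; Balaban1985Averaging, (9) p.19] -/
theorem dist1_comb_cycle_le {k : ℕ} (hk : k ≤ P.m + P.K) (U : GaugeField P 0 G) {δ : ℝ} (hδ : 0 ≤ δ)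
    (hU : ∀ q : Plaq P 0, dist1 (GaugeField.plaqHol U q) ≤ δ) (σ : Equiv.Perm (Fin P.d)) (x : Site P k)
    {z : Site P 0} {ν : Fin P.d} (hz : blockIter k z = x) (hz' : blockIter k (z.shift ν) = x) :
    dist1 (holAt U (walk (embIter k x) (stairWord σ (fun a => ((z a).val : ℤ) - (((embIter k x) a).val : ℤ)))) * U ⟨z, ν⟩ *
        (holAt U (walk (embIter k x) (stairWord σ (fun a => (((z.shift ν) a).val : ℤ) - (((embIter k x) a).val : ℤ)))))⁻¹) ≤
      (((P.d - 1) * ((P.L ^ k - 1) / 2) : ℕ) : ℝ) * δ := by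
  have hzend := walkEnd_comb x σ z
  rw [offset_shift hk x hz hz']
  set n : Fin P.d → ℤ := fun a => ((z a).val : ℤ) - (((embIter k x) a).val : ℤ) with hn
  obtain ⟨pre, post, Pw, ρs, ρt, hsplit, -, -, -, hw, hw', hρ, -⟩ := T4StairWordPrefix.stairWord_update_decomp σ n ν
  -- the shared tail `R = stairRuns n post` has length `≤ |post|·(L^k−1)/2 ≤ (d−1)·(L^k−1)/2`
  have hl := congrArg List.length hsplit
  rw [List.length_map, List.length_finRange, List.length_append, List.length_cons] at hl
  have hlen : (stairRuns n post).length ≤ post.length * ((P.L ^ k - 1) / 2) :=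
    T4StairWordPrefix.length_stairRuns_le n _ post fun a _ => natAbs_offset_le hk x hz a
  have hbs : post.length * ((P.L ^ k - 1) / 2) ≤ (P.d - 1) * ((P.L ^ k - 1) / 2) := Nat.mul_le_mul_right _ (by omega)
  have hcast : ((stairRuns n post).length : ℝ) ≤ (((P.d - 1) * ((P.L ^ k - 1) / 2) : ℕ) : ℝ) := by exact_mod_cast hlen.trans hbs
  rw [hw] at hzend
  rw [hw, hw']
  rcases hρ with ⟨-, hs, ht⟩ | ⟨-, hs, ht⟩
  · subst hs; subst ht
    have key := dist1_cycle_insert_true_le U hδ hU (embIter k x) Pw (stairRuns n post) ν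
    simp only [List.nil_append, List.append_assoc, List.singleton_append] at key hzend ⊢
    rw [hzend] at key
    exact key.trans (mul_le_mul_of_nonneg_right hcast hδ)
  · subst hs; subst ht
    have key := dist1_cycle_insert_false_le U hδ hU (embIter k x) Pw (stairRuns n post) ν
    simp only [List.nil_append, List.append_assoc, List.singleton_append] at key hzend ⊢
    rw [hzend] at key
    exact key.trans (mul_le_mul_of_nonneg_right hcast hδ)

end Comb

/-! ## §4 `SU(2)`: the defect in the door's `ℝ³` currency -/

section SU2

open Literature.MathematicalPhysics.QuantumLattice (su2Quat norm_su2Quat)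
open Literature.MathematicalPhysics.QuantumFieldTheory.Balaban1983to89.B15Prop1ChartSU2 (adSU2)
open Literature.MathematicalPhysics.QuantumFieldTheory.Balaban1983to89.B15Prop1ChartCalculusSU2 (adSU2_adSU2 imQuat_adSU2)
open Literature.MathematicalPhysics.QuantumFieldTheory.Balaban1983to89.T4HaarSU2ExpChart (imQuat norm_imQuat)
open Literature.MathematicalPhysics.QuantumFieldTheory.Balaban1983to89.T4ExpWindowSmallField (dist1_eq_norm_su2Quat_sub_one)

variable {P : Params}

/-- **THE ADJOINT DEFECT**: `‖Ad_g X − X‖ ≤ 2·dist1 g·‖X‖` for `g ∈ SU(2)`, `X ∈ ℝ³` (in `ℍ`: `qYq⁻¹ − Y = ((q−1)Y − Y(q−1))q⁻¹`, `‖q‖ = 1`, `dist1 g = ‖q − 1‖`,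
lit ✓`imQuat_adSU2`, ✓`dist1_eq_norm_su2Quat_sub_one`). [cite: Balaban1985Averaging, (8) p.18 (bookkeeping)] -/
theorem norm_adSU2_sub_self_le (g : Matrix.specialUnitaryGroup (Fin 2) ℂ) (X : EuclideanSpace ℝ (Fin 3)) :
    ‖adSU2 g X - X‖ ≤ 2 * dist1 g * ‖X‖ := by
  rw [← norm_imQuat, map_sub, imQuat_adSU2, dist1_eq_norm_su2Quat_sub_one, ← norm_imQuat X]
  set q := su2Quat g
  set Y := imQuat X
  have hq : ‖q‖ = 1 := norm_su2Quat g
  have hq0 : q ≠ 0 := fun h => by rw [h, norm_zero] at hq; exact zero_ne_one hq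
  have hY : Y * q * q⁻¹ = Y := by rw [mul_assoc, mul_inv_cancel₀ hq0, mul_one]
  have e : q * Y * q⁻¹ - Y = ((q - 1) * Y - Y * (q - 1)) * q⁻¹ := by
    calc q * Y * q⁻¹ - Y = q * Y * q⁻¹ - Y * q * q⁻¹ := by rw [hY]
      _ = (q * Y - Y * q) * q⁻¹ := by rw [sub_mul]
      _ = ((q - 1) * Y - Y * (q - 1)) * q⁻¹ := by congr 1; noncomm_ring
  rw [e, norm_mul, norm_inv, hq, inv_one, mul_one]
  refine (norm_sub_le _ _).trans ?_
  rw [norm_mul, norm_mul, two_mul, add_mul, mul_comm ‖Y‖ ‖q - 1‖]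

/-- `‖Ad_{A⁻¹} w − Ad_B Ad_{C⁻¹} w‖ ≤ 2·dist1(A·B·C⁻¹)·‖w‖`: the defect of two transports is the adjoint defect of the cycle `A·B·C⁻¹`, read through the isometry
`Ad_{A⁻¹}`. [cite: Balaban1985Averaging, (8) p.18 (bookkeeping)] -/
theorem norm_adSU2_inv_sub_adSU2_le (A B C : Matrix.specialUnitaryGroup (Fin 2) ℂ) (w : EuclideanSpace ℝ (Fin 3)) :
    ‖adSU2 A⁻¹ w - adSU2 B (adSU2 C⁻¹ w)‖ ≤ 2 * dist1 (A * B * C⁻¹) * ‖w‖ := by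
  have hiso : ∀ (g : Matrix.specialUnitaryGroup (Fin 2) ℂ) (X : EuclideanSpace ℝ (Fin 3)), ‖adSU2 g X‖ = ‖X‖ := by
    intro g X
    rw [← norm_imQuat, imQuat_adSU2, norm_mul, norm_mul, norm_inv, norm_su2Quat, one_mul, inv_one, mul_one, norm_imQuat]
  have hrew : adSU2 B (adSU2 C⁻¹ w) = adSU2 A⁻¹ (adSU2 (A * B * C⁻¹) w) := by
    rw [adSU2_adSU2, adSU2_adSU2]
    congr 1
    group
  rw [hrew, ← map_sub, hiso]
  have h := norm_adSU2_sub_self_le (A * B * C⁻¹) w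
  rw [← norm_neg, neg_sub] at h
  exact h

/-- ★★ **THE COMB DEFECT ON AN INTERIOR BOND**: for `U₀ : GaugeField P 0 SU(2)` with all plaquettes within `δ ≥ 0` of `1`, `k ≤ m + K`, and a finest bond `⟨z, ν⟩` with both
endpoints in `B^k(x)`:  `‖Ad_{H(z)⁻¹} w − Ad_{U₀⟨z,ν⟩} Ad_{H(z+e_ν)⁻¹} w‖ ≤ (d − 1)·(L^k − 1)·δ·‖w‖` (✓`dist1_comb_cycle_le` × ✓`norm_adSU2_inv_sub_adSU2_le`; `L^k` odd so
`2·((L^k−1)∕2) = L^k − 1`). [cite: Balaban1987RG1, (0.3) p.252; Balaban1989LargeFieldII, p.382; Balaban1985Averaging, (8)-(9) pp.18-19] -/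
theorem norm_comb_defect_le {k : ℕ} (hk : k ≤ P.m + P.K) (U₀ : GaugeField P 0 (Matrix.specialUnitaryGroup (Fin 2) ℂ)) {δ : ℝ} (hδ : 0 ≤ δ)
    (hU : ∀ q : Plaq P 0, dist1 (GaugeField.plaqHol U₀ q) ≤ δ) (σ : Equiv.Perm (Fin P.d)) (x : Site P k)
    {z : Site P 0} {ν : Fin P.d} (hz : blockIter k z = x) (hz' : blockIter k (z.shift ν) = x) (w : EuclideanSpace ℝ (Fin 3)) :
    ‖adSU2 (holAt U₀ (walk (embIter k x) (stairWord σ (fun a => ((z a).val : ℤ) - (((embIter k x) a).val : ℤ)))))⁻¹ w -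
        adSU2 (U₀ ⟨z, ν⟩)
          (adSU2 (holAt U₀ (walk (embIter k x) (stairWord σ (fun a => (((z.shift ν) a).val : ℤ) - (((embIter k x) a).val : ℤ)))))⁻¹ w)‖ ≤
      (((P.d - 1) * (P.L ^ k - 1) : ℕ) : ℝ) * δ * ‖w‖ := by
  refine (norm_adSU2_inv_sub_adSU2_le _ _ _ w).trans ?_
  have hc := dist1_comb_cycle_le hk U₀ hδ hU σ x hz hz'
  have hodd : Odd (P.L ^ k) := P.hL.1.pow
  have hnat : 2 * ((P.d - 1) * ((P.L ^ k - 1) / 2)) = (P.d - 1) * (P.L ^ k - 1) := by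
    obtain ⟨t, ht⟩ := hodd
    rw [ht, Nat.add_sub_cancel, Nat.mul_div_cancel_left t two_pos]
    ring
  have e : (((P.d - 1) * (P.L ^ k - 1) : ℕ) : ℝ) * δ = 2 * ((((P.d - 1) * ((P.L ^ k - 1) / 2) : ℕ) : ℝ) * δ) := by
    rw [← hnat]; push_cast; ring
  refine mul_le_mul_of_nonneg_right ?_ (norm_nonneg w)
  rw [e]
  exact mul_le_mul_of_nonneg_left hc two_pos.le

/-- ★★★ **THE INTERIOR PART OF THE COMB'S GAUGE TANGENT IS THIN, IN SUP NORM.**  With `λ z := Ad_{H(z)⁻¹} w` (`H` the comb transporter of `B^k(x)` rooted at `ι_k x`,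
axis order `σ`) and the interior part `I_w b := [B^k(b₋) = x ∧ B^k(b₊) = x]·(λ b₋ − Ad_{U₀ b} λ b₊)` of the infinitesimal gauge transformation `D_{U₀}λ`:
  `‖I_w‖_∞ ≤ (d − 1)·(L^k − 1)·δ·‖w‖`
whenever every level-`0` plaquette of `U₀` is within `δ ≥ 0` of `1` (`k ≤ m + K`).  With the background's `δ = θ₀ = C₁θ_J(L^k)⁻²` this is the thin-loop letter
`‖I_w‖_∞ ≤ (d−1)C₁·θ_J·(L^{K−J})⁻¹·‖w‖` feeding hypothesis (ii) `‖u_B w‖ ≤ ½‖w‖` of ✓`exists_preimage_curl_of_faceSpreads` through (D2) ✓`norm_qfderiv_apply_le`.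
[cite: Balaban1987RG1, (0.3) p.252; Balaban1989LargeFieldII, p.382; Balaban1985Averaging, (8)-(9) pp.18-19, (125) p.36] -/
theorem norm_interiorPart_le {k : ℕ} (hk : k ≤ P.m + P.K) (U₀ : GaugeField P 0 (Matrix.specialUnitaryGroup (Fin 2) ℂ)) {δ : ℝ} (hδ : 0 ≤ δ)
    (hU : ∀ q : Plaq P 0, dist1 (GaugeField.plaqHol U₀ q) ≤ δ) (σ : Equiv.Perm (Fin P.d)) (x : Site P k) (w : EuclideanSpace ℝ (Fin 3)) :
    ‖(fun b : PBond P 0 =>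
        if blockIter k b.src = x ∧ blockIter k b.tgt = x then
          adSU2 (holAt U₀ (walk (embIter k x) (stairWord σ (fun a => ((b.src a).val : ℤ) - (((embIter k x) a).val : ℤ)))))⁻¹ w -
            adSU2 (U₀ b)
              (adSU2 (holAt U₀ (walk (embIter k x) (stairWord σ (fun a => ((b.tgt a).val : ℤ) - (((embIter k x) a).val : ℤ)))))⁻¹ w)
        else 0)‖ ≤
      (((P.d - 1) * (P.L ^ k - 1) : ℕ) : ℝ) * δ * ‖w‖ := by
  refine (pi_norm_le_iff_of_nonneg (by positivity)).2 fun b => ?_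
  split_ifs with hb
  · exact norm_comb_defect_le hk U₀ hδ hU σ x hb.1 hb.2 w
  · rw [norm_zero]; positivity

end SU2

end Summit.QuantumFields.YangMills.Theorems.FluctuationComparisonRegPrIntLS2BetaCombTransporter
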